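import Summits.Ventures.LatticeQCDFlow.Scaling.SwapLadderRoundTripDEOIrreducible
import Summits.Ventures.LatticeQCDFlow.Scaling.SwapLadderIndexPoissonDEO
import Summits.Ventures.LatticeQCDFlow.Scaling.SwapLadderIndexTauInt

/-!
HONEST FRAMING: exact (Metropolis-corrected) sampling algorithms for lattice gauge theory; figures
of merit are autocorrelation/cost numbers at stated couplings and volumes; no continuum-physics
claim.

# SwapLadderIndexTauIntDEO — THE INTEGRATED AUTOCORRELATION TIME OF THE REPLICA INDEX UNDER THE DRIVER's
# DETERMINISTIC EVEN–ODD SWAP SCHEME, EXACTLY, FOR EVERY ACCEPTANCE PROFILE: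
# `τ_int,DEO = (6/(K(K+1)(K+2)))·Σ_{j<K} (j+1)²(K−j)²·r_j/s_j` SWAP SCANS, AND THE PROFILE-FREE GAP
# `τ_int,reversible − τ_int,DEO = (K²+2K+2)/5 − 1/2` — the `τ_int` twin of GEN-5's round-trip identity
# `RT_SEO − RT_DEO = 2(K+1)(K−1)` (row 22 `su3-ptbc`, GEN-6, ours; part 2 of 2, sequel of `SwapLadderIndexPoissonDEO`)

Venture `LatticeQCDFlow` (cell pub-lqcd), topic `Scaling`; FANOUT row 22 (`su3-ptbc`).  NEW WORK of the cell over part 1,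
GEN-5's `SwapLadderRoundTripDEOIrreducible.deoWalk_isIrreducible`, GEN-6's `SwapLadderIndexTauInt` (`sum_passageWeight_sq`,
the reversible `tauInt_levelObs_profile`, `fundamentalInv_mulVec_apply`) and the Literature vocabulary (`PeskunOrdering`:
Kemeny–Snell **`asympVar`** with `asympVar_eq_centred` — valid for NON-reversible chains —, `isUnit_fundamentalInv`,
`fundamentalInv_mul_fundamentalMatrix`; Mathlib `Matrix.mulVec_injective_iff_isUnit`).  Nothing is cited as a fact; no
`native_decide`.  Profile `0 < a_j ≤ 1` (e.g. the MEASURED per-pair acceptances of a run).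

## What is proved (`w_j = (j+1)(K−j)`)

§4 `isUnit_fundamentalInv_deo` (irreducibility ⇒ `I − (P − A)` invertible), **`fundamentalMatrix_mulVec_centred_deoLevel`**
   (`Z(i − K/2) = g`, part 1's solution).
§5 **`asympVar_deoLevel_profile`** — `v_DEO(index) = (1/(K+1))·Σ_j w_j² r_j/s_j`; **`tauInt_deoLevel_profile`** —
   `v/(2·Var) = (6/(K(K+1)(K+2)))·Σ_j w_j² r_j/s_j` (`K ≥ 1`; Madras–Slade convention, unit = one swap scan);
   **`tauInt_reversible_sub_deo`** — for EVERY profile the reversible walk (`bdKernel` with the same bonds) exceeds the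
   DEO walk by exactly `(K²+2K+2)/5 − 1/2`; `tauInt_deoLevel_flat` (`(K²+2K+2)(1−c)/(5c)`);
   **`tauInt_deoLevel_flat_twenty`** (S2's ladder, `K = 12`, `c = 1/5`, CARD §2: `136` scans `= 17` macro-steps at `8`
   scans, against `169.5` for the reversible scheme — MODEL numbers, not acceptance items).

READING (model only): the driver's non-reversible scheme removes a FIXED `(K²+2K+2)/5 − 1/2` from the index
autocorrelation time WHATEVER the acceptances — `20 %` of it at the card's flat `0.2`, half at `1/2`, all of it as
`a → 1`; the DEO value weighs bond `j` by `r_j/s_j` where the reversible one weighs by `1/s_j` — the same substitution as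
in the round trips (`2(K+1)(1 + Σ r/s)` vs `2(K+1)Σ 1/s`).  Printed context, NAMED ONLY: lifting reduces diffusive
autocorrelations (Diaconis–Holmes–Neal 2000; Syed–Bouchard-Côté–Deligiannidis–Doucet 2022); lean-2's reversible floors /
ceilings for the tempering coordinate (`TemperingLevelTauInt`, W5) do not bind this non-reversible kernel.  NOT CLAIMED:
that PTBC's labels follow the lifted walk (ELE idealisation); `τ_int` of `Q²` at the physical rung (measured by the card).
-/

noncomputable section

open Finset Matrix
open Literature.Probability.MarkovChains

namespace Summit.Ventures.LatticeQCDFlow.Scaling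

/-! ## §4 Invertibility (irreducibility of the lifted walk) and `Z(index − K/2) = g` -/

section Fundamental

variable {K : ℕ} {a : ℕ → ℝ}

/-- `I − (P − A)` is invertible for the lifted walk with the uniform law (`0 < a ≤ 1`). [ours] -/
theorem isUnit_fundamentalInv_deo (ha0 : ∀ j, 0 < a j) (ha1 : ∀ j, a j ≤ 1) :
    IsUnit (1 - (deoWalk K a - limitMatrix (deoUnifLaw K))) :=
  isUnit_fundamentalInv (sum_deoUnifLaw K) (deoWalk_isRowStochastic a (fun j => (ha0 j).le) ha1)
    (deoUnifLaw_isStationary a) (deoWalk_isIrreducible ha0 ha1)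

/-- **`Z (index − K/2) = g`** on the lifted space, every profile. [ours] -/
theorem fundamentalMatrix_mulVec_centred_deoLevel (ha0 : ∀ j, 0 < a j) (ha1 : ∀ j, a j ≤ 1) :
    fundamentalMatrix (deoUnifLaw K) (deoWalk K a) *ᵥ centred (deoUnifLaw K) (deoLevel K) = deoLevelPoisson K a := by
  have hK := isUnit_fundamentalInv_deo (K := K) ha0 ha1
  apply (mulVec_injective_iff_isUnit.2 hK)
  show (1 - (deoWalk K a - limitMatrix (deoUnifLaw K))) *ᵥ
      (fundamentalMatrix (deoUnifLaw K) (deoWalk K a) *ᵥ centred (deoUnifLaw K) (deoLevel K))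
    = (1 - (deoWalk K a - limitMatrix (deoUnifLaw K))) *ᵥ deoLevelPoisson K a
  rw [mulVec_mulVec, fundamentalInv_mul_fundamentalMatrix hK, one_mulVec]
  funext x
  rw [fundamentalInv_mulVec_apply, sum_deoUnifLaw_mul_deoLevelPoisson, add_zero,
    deoLevelPoisson_poisson ha0 ha1 x, centred_deoLevel]

end Fundamental

/-! ## §5 `τ_int` OF THE INDEX UNDER THE DRIVER's SCHEME FOR EVERY PROFILE; THE PROFILE-FREE GAP TO THE REVERSIBLE SCHEME -/

section Main

variable {K : ℕ} {a : ℕ → ℝ}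

/-- **`v_DEO(index) = (1/(K+1))·Σ_{j<K} w_j² r_j/s_j`** (Kemeny–Snell `asympVar`; `0 < a ≤ 1`). [ours] -/
theorem asympVar_deoLevel_profile (ha0 : ∀ j, 0 < a j) (ha1 : ∀ j, a j ≤ 1) :
    asympVar (deoLevel K) (deoUnifLaw K) (deoWalk K a)
      = 1 / ((K : ℝ) + 1) * ∑ j ∈ range K, passageWeight K j ^ 2 * (1 - a j) / a j := by
  rw [asympVar_eq_centred (sum_deoUnifLaw K) (deoWalk_isRowStochastic a (fun j => (ha0 j).le) ha1)
      (deoUnifLaw_isStationary a) (isUnit_fundamentalInv_deo ha0 ha1),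
    fundamentalMatrix_mulVec_centred_deoLevel ha0 ha1, piInner_centred_deoLevel_deoLevelPoisson, piInner_centred_deoLevel]
  have e : ∑ j ∈ range K, passageWeight K j ^ 2 * (1 - a j) / (2 * a j)
      = 1 / 2 * ∑ j ∈ range K, passageWeight K j ^ 2 * (1 - a j) / a j := by
    rw [mul_sum]
    refine sum_congr rfl fun j _ => ?_
    have := (ha0 j).ne'
    field_simp
  rw [e]
  ring

/-- **`τ_int,DEO(index) = (6/(K(K+1)(K+2)))·Σ_{j<K} (j+1)²(K−j)²·r_j/s_j`** scans, for EVERY profile (`K ≥ 1`). [ours] -/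
theorem tauInt_deoLevel_profile (ha0 : ∀ j, 0 < a j) (ha1 : ∀ j, a j ≤ 1) (hK : 1 ≤ K) :
    asympVar (deoLevel K) (deoUnifLaw K) (deoWalk K a)
        / (2 * piInner (deoUnifLaw K) (centred (deoUnifLaw K) (deoLevel K)) (centred (deoUnifLaw K) (deoLevel K)))
      = 6 / ((K : ℝ) * (K + 1) * (K + 2)) * ∑ j ∈ range K, passageWeight K j ^ 2 * (1 - a j) / a j := by
  rw [asympVar_deoLevel_profile ha0 ha1, piInner_centred_deoLevel]
  have hK0 : (0 : ℝ) < K := by exact_mod_cast hK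
  have h1 : (K : ℝ) * (K + 2) ≠ 0 := by positivity
  have h2 : (K : ℝ) + 1 ≠ 0 := by positivity
  field_simp
  ring

/-- **THE TWO SCHEMES DIFFER BY A PROFILE-INDEPENDENT AMOUNT**: for EVERY acceptance profile,
`τ_int,reversible − τ_int,DEO = (K² + 2K + 2)/5 − 1/2` (the reversible value is part 2's `tauInt_levelObs_profile`
on the `bdKernel` with the same bond profile). [ours] -/
theorem tauInt_reversible_sub_deo {p q : ℕ → ℝ} (ha0 : ∀ j, 0 < a j) (ha1 : ∀ j, a j ≤ 1) (hK : 1 ≤ K)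
    (hP : IsRowStochastic (bdKernel K p q)) (hp : ∀ k, k < K → p k = a k / 2) (hpK : p K = 0) (hq0 : q 0 = 0)
    (hq : ∀ k, 1 ≤ k → k ≤ K → q k = a (k - 1) / 2) :
    asympVar (levelObs K) (unifLaw K) (bdKernel K p q)
        / (2 * piInner (unifLaw K) (centred (unifLaw K) (levelObs K)) (centred (unifLaw K) (levelObs K)))
      - asympVar (deoLevel K) (deoUnifLaw K) (deoWalk K a)
        / (2 * piInner (deoUnifLaw K) (centred (deoUnifLaw K) (deoLevel K)) (centred (deoUnifLaw K) (deoLevel K)))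
      = ((K : ℝ) ^ 2 + 2 * K + 2) / 5 - 1 / 2 := by
  rw [tauInt_levelObs_profile (fun k _ => ha0 k) hK hP hp hpK hq0 hq, tauInt_deoLevel_profile ha0 ha1 hK]
  have hsplit : ∑ j ∈ range K, passageWeight K j ^ 2 / a j - ∑ j ∈ range K, passageWeight K j ^ 2 * (1 - a j) / a j
      = ∑ j ∈ range K, passageWeight K j ^ 2 := by
    rw [← sum_sub_distrib]
    refine sum_congr rfl fun j _ => ?_
    have := (ha0 j).ne'
    field_simp
    ring
  have hK0 : (0 : ℝ) < K := by exact_mod_cast hK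
  have h1 : (K : ℝ) * (K + 1) * (K + 2) ≠ 0 := by positivity
  calc 6 / ((K : ℝ) * (K + 1) * (K + 2)) * ∑ j ∈ range K, passageWeight K j ^ 2 / a j - 1 / 2
        - 6 / ((K : ℝ) * (K + 1) * (K + 2)) * ∑ j ∈ range K, passageWeight K j ^ 2 * (1 - a j) / a j
      = 6 / ((K : ℝ) * (K + 1) * (K + 2)) * (∑ j ∈ range K, passageWeight K j ^ 2 / a j
          - ∑ j ∈ range K, passageWeight K j ^ 2 * (1 - a j) / a j) - 1 / 2 := by ring
    _ = 6 / ((K : ℝ) * (K + 1) * (K + 2)) * ∑ j ∈ range K, passageWeight K j ^ 2 - 1 / 2 := by rw [hsplit]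
    _ = ((K : ℝ) ^ 2 + 2 * K + 2) / 5 - 1 / 2 := by
        rw [sum_passageWeight_sq]
        field_simp
        ring

/-- **FLAT LADDER under the driver's scheme: `τ_int = (K² + 2K + 2)(1 − c)/(5c)`** (`a_j = c ∈ (0,1]`, `K ≥ 1`). [ours] -/
theorem tauInt_deoLevel_flat {c : ℝ} (hc0 : 0 < c) (hc1 : c ≤ 1) (hK : 1 ≤ K) :
    asympVar (deoLevel K) (deoUnifLaw K) (deoWalk K (fun _ => c))
        / (2 * piInner (deoUnifLaw K) (centred (deoUnifLaw K) (deoLevel K)) (centred (deoUnifLaw K) (deoLevel K)))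
      = ((K : ℝ) ^ 2 + 2 * K + 2) * (1 - c) / (5 * c) := by
  rw [tauInt_deoLevel_profile (fun _ => hc0) (fun _ => hc1) hK]
  have e : ∑ j ∈ range K, passageWeight K j ^ 2 * (1 - c) / c = (∑ j ∈ range K, passageWeight K j ^ 2) * ((1 - c) / c) := by
    rw [sum_mul]; exact sum_congr rfl fun j _ => by ring
  rw [e, sum_passageWeight_sq]
  have hK0 : (0 : ℝ) < K := by exact_mod_cast hK
  field_simp
  ring

/-- **S2's ladder under the driver's scheme** (`K = 12`, `c = 1/5`): `136` scans (`= 17` macro-steps at `8` scans;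
reversible: `169.5`; MODEL numbers). [ours] -/
theorem tauInt_deoLevel_flat_twenty :
    asympVar (deoLevel 12) (deoUnifLaw 12) (deoWalk 12 (fun _ => (1 / 5 : ℝ)))
        / (2 * piInner (deoUnifLaw 12) (centred (deoUnifLaw 12) (deoLevel 12)) (centred (deoUnifLaw 12) (deoLevel 12)))
      = 136 := by
  rw [tauInt_deoLevel_flat (by norm_num) (by norm_num) (by norm_num)]
  norm_num

end Main

end Summit.Ventures.LatticeQCDFlow.Scaling
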